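import Literature.Combinatorics.Optimization.PseudoBooleanMultilinear
import Literature.Computability.MetaComplexity.LowDegreeTwoModuliExpSums
import Literature.Computability.Complexity.NisanSzegedyJunta
import Literature.Computability.MetaComplexity.HypercubeSchwartzZippel
import HarnessLib

/-!
# Modular degree versus integer degree of a Boolean function: `deg_p f ≤ d` with `2^d < p` forces `deg f ≤ d`, hence a `d·2^{d−1}`-junta

SETTING. A Boolean function `f : {0,1}^ι → {0,1}` has a unique multilinear representation
`f = Σ_S c_S x_S` over `ℤ`, with INTEGER Möbius coefficients `c_S = Σ_{T ⊆ S} (−1)^{|S∖T|} f(𝟙_T)`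
(the tree's `PseudoBoolean.coeff`, Boros–Hammer Prop. 2 [BorosHammer2002]; O'Donnell Ex. 1.9
[ODonnell2014]); its representation over `ℤ_m` is `Σ_S (c_S mod m) x_S`
([SunSunWangWuXiaZheng2020, Fact 2.1]; [LiSun2017, Fact 1]); `deg(f)` / `deg_m(f)` are the
degrees of these representations ([SunSunWangWuXiaZheng2020, Def. 2.2]), and `deg_m(f) ≤ deg(f)`,
`deg_m(f|_σ) ≤ deg_m(f)` for restrictions ([SunSunWangWuXiaZheng2020, Fact 2.5]).  In the tree the
"functions of degree `≤ d` over `R`" on the cube are the submodule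
`TwoModuli.degLE R ι d = span_R {x_S : |S| ≤ d}` (`Literature/Computability/MetaComplexity/
LowDegreeTwoModuliExpSums`; for a field and `ι = Fin n` this is `Smolensky.lowDeg`, `rfl`), and real
degree `≤ d` on `{0,1}^m` in Fourier form is `IsLevelLE d` (`FourierDegreeAlgebra`).

THE PRINTED NEIGHBOURHOOD.  Gopalan–Lovett–Shpilka [GopalanLovettShpilka2010, §1.1]: "having low
degree mod `p` … is a 'singular' event, in the sense it can only occur for at most one characteristic
`p`" (Thm 1.2: `deg_q(f) ≥ n/(⌈log₂ p⌉ deg_p(f) p^{2deg_p(f)})`; display after Cor. 1.3: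
`deg(f) ≥ n/2^{deg_p(f)}` for `f` depending on all `n` variables).  Sun–Sun–Wang–Wu–Xia–Zheng
[SunSunWangWuXiaZheng2020, Thm 1.4]: "For any prime `p`, positive integer `k`, and non-degenerate
function `f : {0,1}ⁿ → {0,1}` with sufficiently large `n`, `deg_{p^k}(f) ≥ (p − 1)·k`.  The bound
`(p−1)·k` is tight."  — so a Boolean function of `𝔽_p`-degree `≤ p − 2` depends on fewer than `N(p)`
variables, with `N(p)` of tower type (their Lemma 3.6: Simon's sensitivity bound + Erdős–Rado).

WHAT IS PROVED HERE (all theorems, 0 named facts).  The EXPLICIT small-degree window of that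
phenomenon, by an elementary argument on the integer coefficients (we know no printed locator for
this exact statement; the ingredients are the cited Facts):

* §1 coefficient calculus for `PseudoBoolean.coeff` (any commutative ring, any index type):
  additivity/homogeneity/ring-hom compatibility (`coeff_add`, `coeff_smul`, `coeff_sub`, `coeff_map`),
  the RESTRICTION RECURSION `c_{S ∪ {i}}(f) = c_S(f|_{x_i=1}) − c_S(f|_{x_i=0})` (`coeff_insert`),
  vanishing at sets containing a dumb coordinate (`coeff_eq_zero_of_forall_insert_eq`), and the bound
  `|c_S(g)| ≤ 2^{|S|}` for `|g| ≤ 1` (`abs_coeff_le_two_pow_card`; O'Donnell Ex. 1.9(c)).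
* §2 **`coeff_eq_zero_of_prime_dvd`** — the engine: if `f` is `{0,1}`-valued, `2^d < p`, and
  `p ∣ c_S(f)` for all `|S| > d`, then `c_S(f) = 0` for all `|S| > d`.  Proof: induction on `|S|`;
  for `|S| = d + 1`, `c_S(f) = c_{S∖i}(f|_{x_i=1} − f|_{x_i=0})` has absolute value `≤ 2^d < p`; for
  `|S| ≥ d + 2` both restrictions are Boolean and inherit the divisibility hypothesis
  (`c_T(f|_{x_i=1}) = c_T(f) + c_{T∪i}(f)`), so the recursion and the induction hypothesis give `0`.
  (The one-step bound alone does not suffice: `|c_S| ≤ 2^{|S|−1}` exceeds `p` for large `S`.)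
* §3 the bridge `degLE ↔ coefficients` on the cube `{0,1}^ι` (`Fintype ι`):
  `coeff_table_eq_zero_of_mem_degLE`, `mem_degLE_of_coeff_table_eq_zero`.
* §4 **`mem_degLE_int_of_mem_degLE_zmod`**: `𝟙_f ∈ degLE (ZMod p) ι d`, `2^d < p` ⟹
  `𝟙_f ∈ degLE ℤ ι d`, and **`mem_degLE_of_mem_degLE_zmod`** (same over every commutative ring, e.g.
  `ℝ`, `ℚ`, `ZMod q`): "`deg_p(f) ≤ d ∧ 2^d < p ⟹ deg(f) ≤ d`", equivalently
  `deg_p(f) ≥ min(deg(f), log₂ p)`.  Sharpness of the window: `p = 3, d = 2`,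
  `[x₁+x₂+x₃ = 2] = x₁x₂ + x₁x₃ + x₂x₃ − 3x₁x₂x₃` has `deg₃ = 2 < deg = 3`.
* §5 Fourier form and the junta corollary on `{0,1}^m`: `isLevelLE_of_mem_degLE` (`degLE ℝ ⊆
  IsLevelLE`), **`isLevelLE_of_mem_degLE_zmod`**, and with the tree's Nisan–Szegedy theorem
  (`nisanSzegedy_junta`) **`junta_of_mem_degLE_zmod`** / **`junta_of_mem_lowDeg_zmod`**: a Boolean
  function of `𝔽_p`-degree `≤ d` with `2^d < p` depends on at most `d·2^{d−1}` coordinates.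
* §6 sharpness of the window at `(p, d) = (3, 2)` by `decide`.
* §7 the Gopalan–Lovett–Shpilka strengthening of Nisan–Szegedy [GopalanLovettShpilka2010, §1.1]:
  `derivAt_mem_degLE` (`Δ_i` lowers `degLE` by one, any ring), **`influence_ge_of_mem_degLE_zmod`**
  (relevant coordinates of a Boolean `f` with `deg_p f ≤ d` have influence `≥ 2^{−(d−1)}`, by the tree's
  Schwartz–Zippel `Smolensky.two_pow_le_two_pow_mul_card_support`), **`card_relevant_le_of_mem_degLE_zmod`**
  and **`junta_of_mem_degLE_zmod_of_isLevelLE`**: `#relevant ≤ deg(f)·2^{deg_p(f)−1}`.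

Consumers: cell qa-qnc0 (QuantumAdvantage/AdviceFreeQNC0, OddPrimeWalk success ladder, rung (A)
"tiny `𝔽_p`-degree ⇒ junta": the players' `HasDegF p y d` is `𝟙_y ∈ Smolensky.lowDeg (ZMod p) n d`).

## References
* [SunSunWangWuXiaZheng2020] X. Sun, Y. Sun, J. Wang, K. Wu, Z. Xia, Y. Zheng, *On the degree of
  Boolean functions as polynomials over ℤ_m*, ICALP 2020, LIPIcs 168, 100:1–19 (held text
  `paper:doi-10-4230-lipics-icalp-2020-100`): Fact 2.1, Def. 2.2, Fact 2.5 (p. 100:5), Thm 1.4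
  (p. 100:4), §3.2 (pp. 100:11–12).
* [GopalanLovettShpilka2010] P. Gopalan, S. Lovett, A. Shpilka, *The complexity of Boolean functions
  in different characteristics*, Comput. Complexity 19 (2010) 235–263 (CCC 2009; ECCC TR09-048, read:
  §1.1 p. 3, Thm 1.2, Cor. 1.3 and the display `deg(f) ≥ n/2^{deg_p(f)}`).
* [LiSun2017] Q. Li, X. Sun, *On the modulo degree complexity of Boolean functions*, COCOON 2017,
  LNCS 10392, 384–395: §2 Facts 1–5.
* [ODonnell2014] R. O'Donnell, *Analysis of Boolean Functions*, CUP 2014: Ex. 1.9 (integer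
  coefficients of the `{0,1}`-representation, uniqueness), Ex. 1.10(b), Ex. 1.11(a) (same degree as the
  Fourier expansion).
* [BorosHammer2002] E. Boros, P. L. Hammer, Discrete Appl. Math. 123 (2002), §4.1 Prop. 2.
* [NisanSzegedy1994] N. Nisan, M. Szegedy, Comput. Complexity 4 (1994) 301–313 (junta theorem).
-/

noncomputable section

namespace Literature.Computability.Complexity.LowDegree

open Finset
open Literature.Combinatorics.Optimization
open Literature.Combinatorics.Optimization.PseudoBoolean
open Literature.Computability.MetaComplexity.TwoModuli

namespace ModularDegree

/-! ### §1 Coefficient calculus for the Möbius coefficients `PseudoBoolean.coeff` -/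

section Coeff

variable {ι : Type*} {R : Type*} [CommRing R]

/-- Additivity of the Möbius coefficients `c_S(f) = Σ_{T⊆S} (−1)^{|S|−|T|} f(𝟙_T)`.
[cite: BorosHammer2002, §4.1 Prop. 2 (the linear system (12))] -/
theorem coeff_add (f g : Finset ι → R) (S : Finset ι) :
    coeff (fun T => f T + g T) S = coeff f S + coeff g S := by
  unfold coeff
  rw [← sum_add_distrib]
  exact sum_congr rfl fun T _ => by ring

/-- Homogeneity of the Möbius coefficients. [cite: BorosHammer2002, §4.1 Prop. 2 (the linear system (12))] -/
theorem coeff_smul (a : R) (f : Finset ι → R) (S : Finset ι) :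
    coeff (fun T => a * f T) S = a * coeff f S := by
  unfold coeff
  rw [mul_sum]
  exact sum_congr rfl fun T _ => by ring

/-- The Möbius coefficients of a difference. [cite: BorosHammer2002, §4.1 Prop. 2 (the linear system (12))] -/
theorem coeff_sub (f g : Finset ι → R) (S : Finset ι) :
    coeff (fun T => f T - g T) S = coeff f S - coeff g S := by
  unfold coeff
  rw [← sum_sub_distrib]
  exact sum_congr rfl fun T _ => by ring

/-- The zero table has zero coefficients. [cite: BorosHammer2002, §4.1 Prop. 2] -/
theorem coeff_zero (S : Finset ι) : coeff (fun _ : Finset ι => (0 : R)) S = 0 := by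
  unfold coeff
  simp

/-- **Reduction modulo `m` / change of ring**: the Möbius coefficients of `φ ∘ f` are the images of
those of `f` under a ring homomorphism `φ` ("the polynomial `Σ_S (c_S mod m) Π x_i` represents `f`
over `ℤ_m`"). [cite: SunSunWangWuXiaZheng2020, Fact 2.1] [cite: LiSun2017, §2 Fact 1] -/
theorem coeff_map {R' : Type*} [CommRing R'] (φ : R →+* R') (f : Finset ι → R) (S : Finset ι) :
    coeff (fun T => φ (f T)) S = φ (coeff f S) := by
  unfold coeff
  rw [map_sum]
  exact sum_congr rfl fun T _ => by rw [map_mul, map_pow, map_neg, map_one]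

/-- **Restriction recursion** (the coefficient form of "substituting a variable by its value",
[cite: SunSunWangWuXiaZheng2020, Def. 2.4 + Fact 2.5 (restrictions)]): for `i ∉ S`,
`c_{S ∪ {i}}(f) = c_S(f|_{x_i = 1}) − c_S(f|_{x_i = 0})`, where on the sets `T ⊆ S` (all avoiding `i`)
the restriction `x_i = 1` is `T ↦ f(T ∪ {i})` and `x_i = 0` is `f` itself. [cite: ODonnell2014, Ex. 1.9 (the {0,1}-representation)] -/
theorem coeff_insert [DecidableEq ι] (f : Finset ι → R) {i : ι} {S : Finset ι} (hi : i ∉ S) :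
    coeff f (insert i S) = coeff (fun T => f (insert i T)) S - coeff f S := by
  unfold coeff
  have hdisj : Disjoint S.powerset (S.powerset.image (insert i)) := by
    rw [disjoint_left]
    intro T hT hT'
    obtain ⟨U, -, rfl⟩ := mem_image.1 hT'
    exact hi (mem_powerset.1 hT (mem_insert_self i U))
  have hinj : Set.InjOn (insert i) (S.powerset : Set (Finset ι)) := by
    intro U hU V hV hUV
    have hiU : i ∉ U := fun h => hi (mem_powerset.1 (mem_coe.1 hU) h)
    have hiV : i ∉ V := fun h => hi (mem_powerset.1 (mem_coe.1 hV) h)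
    rw [← erase_insert hiU, hUV, erase_insert hiV]
  rw [powerset_insert, sum_union hdisj, sum_image hinj, card_insert_of_notMem hi]
  have h1 : ∑ T ∈ S.powerset, (-1 : R) ^ (S.card + 1 - T.card) * f T =
      -∑ T ∈ S.powerset, (-1 : R) ^ (S.card - T.card) * f T := by
    rw [← neg_one_mul (∑ T ∈ S.powerset, _), mul_sum]
    refine sum_congr rfl fun T hT => ?_
    have hle : T.card ≤ S.card := card_le_card (mem_powerset.1 hT)
    rw [show S.card + 1 - T.card = (S.card - T.card) + 1 by omega, pow_succ]
    ring
  have h2 : ∑ T ∈ S.powerset, (-1 : R) ^ (S.card + 1 - (insert i T).card) * f (insert i T) =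
      ∑ T ∈ S.powerset, (-1 : R) ^ (S.card - T.card) * f (insert i T) := by
    refine sum_congr rfl fun T hT => ?_
    have hiT : i ∉ T := fun h => hi (mem_powerset.1 hT h)
    rw [card_insert_of_notMem hiT, Nat.add_sub_add_right]
  rw [h1, h2]
  ring

/-- A table that does not see coordinate `i` (`f(T ∪ {i}) = f(T)` for all `T`) has zero coefficient
at every `S ∋ i` ("dumb bit", [cite: SunSunWangWuXiaZheng2020, §2.1 (non-degenerate / dumb bit)]).
[cite: ODonnell2014, Ex. 1.9 (uniqueness of the {0,1}-representation)] -/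
theorem coeff_eq_zero_of_forall_insert_eq [DecidableEq ι] (f : Finset ι → R) {i : ι}
    (hf : ∀ T, f (insert i T) = f T) {S : Finset ι} (hi : i ∈ S) : coeff f S = 0 := by
  rw [← insert_erase hi, coeff_insert f (notMem_erase i S)]
  have : (fun T => f (insert i T)) = f := funext hf
  rw [this, sub_self]

/-- The crude bound: a table with values in `[−1, 1]` has `|c_S| ≤ 2^{|S|}` (`2^{|S|}` terms of
absolute value `≤ 1`). [cite: ODonnell2014, Ex. 1.9(c) (coefficients are integers in [−2ⁿ, 2ⁿ])] -/
theorem abs_coeff_le_two_pow_card (f : Finset ι → ℤ) (hf : ∀ T, |f T| ≤ 1) (S : Finset ι) :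
    |coeff f S| ≤ 2 ^ S.card := by
  unfold coeff
  calc |∑ T ∈ S.powerset, (-1 : ℤ) ^ (S.card - T.card) * f T|
      ≤ ∑ T ∈ S.powerset, |(-1 : ℤ) ^ (S.card - T.card) * f T| := abs_sum_le_sum_abs _ _
    _ ≤ ∑ T ∈ S.powerset, (1 : ℤ) := sum_le_sum fun T _ => by
        rw [abs_mul, abs_pow, abs_neg, abs_one, one_pow, one_mul]
        exact hf T
    _ = 2 ^ S.card := by rw [sum_const, card_powerset]; simp

end Coeff

/-! ### §2 The engine: divisibility by a prime `p > 2^d` above degree `d` forces vanishing -/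

section Engine

variable {ι : Type*} [DecidableEq ι]

/-- **Engine.** Let `f` be a `{0,1}`-valued table (a Boolean function read on supports), `p` a prime
with `2^d < p`, and suppose `p ∣ c_S(f)` for every `|S| > d` (i.e. `deg_p(f) ≤ d`,
[cite: SunSunWangWuXiaZheng2020, Fact 2.1 + Def. 2.2]).  Then `c_S(f) = 0` for every `|S| > d`
(i.e. `deg(f) ≤ d`).  Induction on `|S|` via the restriction recursion `coeff_insert`; base
`|S| = d + 1` by `abs_coeff_le_two_pow_card`. (Explicit small-degree window of
[cite: SunSunWangWuXiaZheng2020, Thm 1.4]; this statement and proof: no printed locator known.)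
[cite: ODonnell2014, Ex. 1.9(c)] -/
theorem coeff_eq_zero_of_prime_dvd {p d : ℕ} (hp : p.Prime) (hpd : 2 ^ d < p)
    (f : Finset ι → ℤ) (hf : ∀ T, f T = 0 ∨ f T = 1)
    (hdiv : ∀ S : Finset ι, d < S.card → (p : ℤ) ∣ coeff f S)
    (S : Finset ι) (hS : d < S.card) : coeff f S = 0 := by
  -- strong induction on `|S|`, for all Boolean tables at once
  suffices key : ∀ (n : ℕ) (g : Finset ι → ℤ), (∀ T, g T = 0 ∨ g T = 1) →
      (∀ U : Finset ι, d < U.card → (p : ℤ) ∣ coeff g U) →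
      ∀ U : Finset ι, U.card = n → d < U.card → coeff g U = 0 from
    key S.card f hf hdiv S rfl hS
  have hp1 : (1 : ℤ) < p := by exact_mod_cast hp.one_lt
  intro n
  induction n using Nat.strong_induction_on with
  | _ n ih =>
    intro g hg hgdiv U hUn hdU
    obtain ⟨i, hi⟩ : U.Nonempty := card_pos.1 (by omega)
    have hU : insert i (U.erase i) = U := insert_erase hi
    have hiU : i ∉ U.erase i := notMem_erase i U
    have hcardU : (U.erase i).card + 1 = U.card := card_erase_add_one hi
    -- the restriction `x_i = 1`
    set g₁ : Finset ι → ℤ := fun T => g (insert i T) with hg₁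
    have hg₁01 : ∀ T, g₁ T = 0 ∨ g₁ T = 1 := fun T => hg _
    rw [← hU, coeff_insert g hiU]
    by_cases hbase : (U.erase i).card = d
    · -- base case `|U| = d + 1`: the difference is divisible by `p` and bounded by `2^d < p`
      have hdvd : (p : ℤ) ∣ coeff g₁ (U.erase i) - coeff g (U.erase i) := by
        rw [← coeff_insert g hiU, hU]; exact hgdiv U hdU
      have hbound : |coeff g₁ (U.erase i) - coeff g (U.erase i)| < p := by
        rw [← coeff_sub]
        have hle := abs_coeff_le_two_pow_card (fun T => g₁ T - g T) (fun T => by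
          rcases hg₁01 T with h1 | h1 <;> rcases hg T with h2 | h2 <;> simp [h1, h2]) (U.erase i)
        calc |coeff (fun T => g₁ T - g T) (U.erase i)| ≤ 2 ^ (U.erase i).card := hle
          _ = 2 ^ d := by rw [hbase]
          _ < p := by exact_mod_cast hpd
      exact Int.eq_zero_of_abs_lt_dvd hdvd hbound
    · -- inductive case `|U| ≥ d + 2`: both restrictions have vanishing coefficient at `U ∖ {i}`
      have hdU' : d < (U.erase i).card := by omega
      have hlt : (U.erase i).card < n := by omega
      have h0 : coeff g (U.erase i) = 0 := ih _ hlt g hg hgdiv _ rfl hdU'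
      -- the restriction `x_i = 1` inherits the divisibility hypothesis
      have hg₁div : ∀ V : Finset ι, d < V.card → (p : ℤ) ∣ coeff g₁ V := by
        intro V hV
        by_cases hiV : i ∈ V
        · rw [coeff_eq_zero_of_forall_insert_eq g₁ (fun T => by simp [hg₁]) hiV]
          exact dvd_zero _
        · have hrec : coeff g₁ V = coeff g (insert i V) + coeff g V := by
            rw [coeff_insert g hiV]; ring
          rw [hrec]
          refine dvd_add (hgdiv _ ?_) (hgdiv _ hV)
          rw [card_insert_of_notMem hiV]; omega
      have h1 : coeff g₁ (U.erase i) = 0 := ih _ hlt g₁ hg₁01 hg₁div _ rfl hdU'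
      rw [h0, h1, sub_zero]

end Engine

/-! ### §3 The bridge between `degLE` on the cube `{0,1}^ι` and the Möbius coefficients -/

section Bridge

variable {ι : Type*} [Fintype ι] [DecidableEq ι] {R : Type*} [CommRing R]

/-- Reading a cube function on supports and back: `𝟙_{supp x} = x`.
[cite: BorosHammer2002, §4.1 (proof of Prop. 2: the characteristic vectors 𝟙_S)] -/
theorem decide_mem_support (x : ι → Bool) : (fun j => decide (j ∈ support x)) = x := by
  funext j
  simp

/-- The support of the characteristic vector `𝟙_T` is `T`.
[cite: BorosHammer2002, §4.1 (proof of Prop. 2: the characteristic vectors 𝟙_S)] -/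
theorem support_decide_mem (T : Finset ι) : support (fun j => decide (j ∈ T)) = T := by
  ext j
  simp

/-- The value table of a monomial `x_U` on supports is `[U ⊆ T]`.
[cite: BorosHammer2002, §4.1 (display (12))] -/
theorem cubeMono_decide_mem (U T : Finset ι) :
    cubeMono R U (fun j => decide (j ∈ T)) = monomialAt U T := by
  rw [cubeMono_apply, monomialAt_eq]
  simp [Finset.subset_iff]

/-- The Möbius coefficients of a monomial `x_U`: `c_S(x_U) = [S = U]` (uniqueness of the
representation). [cite: BorosHammer2002, §4.1 Prop. 2 (uniqueness)] -/
theorem coeff_cubeMono (U S : Finset ι) :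
    coeff (fun T => cubeMono R U (fun j => decide (j ∈ T))) S = if S = U then 1 else 0 := by
  have h : (fun S => if S = U then (1 : R) else 0) =
      coeff (fun T => cubeMono R U (fun j => decide (j ∈ T))) := by
    refine eq_coeff_of_forall_multilinear_eq fun T => ?_
    unfold multilinear
    rw [cubeMono_decide_mem]
    simp [Finset.sum_ite_eq']
  exact (congrFun h S).symm

/-- **`degLE ⟹` vanishing coefficients**: a cube function in `span{x_S : |S| ≤ d}` has `c_S = 0` for
all `|S| > d` ("the degree is the size of the largest `S` with `c_S ≠ 0`").
[cite: SunSunWangWuXiaZheng2020, Def. 2.2] [cite: ODonnell2014, Ex. 1.10(b)] -/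
theorem coeff_table_eq_zero_of_mem_degLE {d : ℕ} {F : (ι → Bool) → R} (hF : F ∈ degLE R ι d)
    (S : Finset ι) (hS : d < S.card) :
    coeff (fun T => F (fun j => decide (j ∈ T))) S = 0 := by
  unfold degLE at hF
  induction hF using Submodule.span_induction with
  | mem G hG =>
    obtain ⟨⟨U, hU⟩, rfl⟩ := hG
    rw [coeff_cubeMono, if_neg]
    rintro rfl
    exact absurd hU (by simpa using hS)
  | zero => exact coeff_zero S
  | add G H _ _ hG hH =>
    have := coeff_add (fun T => G (fun j => decide (j ∈ T))) (fun T => H (fun j => decide (j ∈ T))) S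
    simp only [Pi.add_apply]
    rw [this, hG, hH, add_zero]
  | smul a G _ hG =>
    have := coeff_smul a (fun T => G (fun j => decide (j ∈ T))) S
    simp only [Pi.smul_apply, smul_eq_mul]
    rw [this, hG, mul_zero]

/-- **Möbius inversion on the cube**: every cube function is `Σ_S c_S · x_S` with `c = coeff` of its
value table. [cite: BorosHammer2002, §4.1 Prop. 2 (existence), §2 eq. (1)] -/
theorem eq_sum_coeff_smul_cubeMono (F : (ι → Bool) → R) :
    F = ∑ S : Finset ι, coeff (fun T => F (fun j => decide (j ∈ T))) S • cubeMono R S := by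
  funext x
  rw [Finset.sum_apply]
  simp only [Pi.smul_apply, smul_eq_mul]
  have h1 := multilinear_support (R := R) (coeff fun T => F (fun j => decide (j ∈ T))) x
  have h2 := multilinear_coeff (fun T => F (fun j => decide (j ∈ T))) (support x)
  simp only [decide_mem_support] at h2
  rw [h2] at h1
  rw [← h1]
  refine sum_congr rfl fun S _ => ?_
  rw [cubeMono_apply, prod_boole]

/-- **Vanishing coefficients ⟹ `degLE`**: if `c_S = 0` for all `|S| > d` then the cube function
lies in `span{x_S : |S| ≤ d}`. [cite: SunSunWangWuXiaZheng2020, Def. 2.2] [cite: ODonnell2014, Ex. 1.10(b)] -/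
theorem mem_degLE_of_coeff_table_eq_zero {d : ℕ} (F : (ι → Bool) → R)
    (hF : ∀ S : Finset ι, d < S.card → coeff (fun T => F (fun j => decide (j ∈ T))) S = 0) :
    F ∈ degLE R ι d := by
  rw [eq_sum_coeff_smul_cubeMono F]
  refine Submodule.sum_mem _ fun S _ => ?_
  by_cases hS : S.card ≤ d
  · exact Submodule.smul_mem _ _ (cubeMono_mem_degLE hS)
  · rw [hF S (by omega), zero_smul]
    exact Submodule.zero_mem _

/-- The two directions together: `F ∈ degLE R ι d ↔ c_S(F) = 0` for all `|S| > d`.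
[cite: SunSunWangWuXiaZheng2020, Def. 2.2 (degree = size of the largest S with c_S ≠ 0)] -/
theorem mem_degLE_iff_coeff_table {d : ℕ} (F : (ι → Bool) → R) :
    F ∈ degLE R ι d ↔
      ∀ S : Finset ι, d < S.card → coeff (fun T => F (fun j => decide (j ∈ T))) S = 0 :=
  ⟨fun h => coeff_table_eq_zero_of_mem_degLE h, mem_degLE_of_coeff_table_eq_zero F⟩

end Bridge

/-! ### §4 Small modular degree forces small integer degree -/

section Main

variable {ι : Type*} [Fintype ι] [DecidableEq ι]

/-- The integer coefficients of a Boolean function of `𝔽_p`-degree `≤ d` with `2^d < p` vanish above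
`d`. [cite: SunSunWangWuXiaZheng2020, Fact 2.1 + Thm 1.4 (window 2^d < p; explicit statement: no printed locator known)] -/
theorem coeff_indicator_eq_zero_of_mem_degLE_zmod {p : ℕ} [hp : Fact p.Prime] {d : ℕ}
    (hpd : 2 ^ d < p) (f : (ι → Bool) → Bool)
    (hf : (fun x => if f x then (1 : ZMod p) else 0) ∈ degLE (ZMod p) ι d)
    (S : Finset ι) (hS : d < S.card) :
    coeff (fun T => if f (fun j => decide (j ∈ T)) then (1 : ℤ) else 0) S = 0 := by
  refine coeff_eq_zero_of_prime_dvd hp.out hpd _ (fun T => by split_ifs <;> simp) ?_ S hS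
  intro U hU
  have h0 := coeff_table_eq_zero_of_mem_degLE hf U hU
  have hcast : (fun T : Finset ι => if f (fun j => decide (j ∈ T)) then (1 : ZMod p) else 0) =
      fun T => (Int.castRingHom (ZMod p))
        ((fun T : Finset ι => if f (fun j => decide (j ∈ T)) then (1 : ℤ) else 0) T) := by
    funext T
    by_cases h : f (fun j => decide (j ∈ T)) <;> simp [h]
  rw [hcast, coeff_map] at h0
  exact (ZMod.intCast_zmod_eq_zero_iff_dvd _ p).1 h0

/-- **Modular degree vs integer degree.**  If a Boolean function `f : {0,1}^ι → {0,1}` has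
`𝔽_p`-degree `≤ d` (its indicator lies in `degLE (ZMod p) ι d`) and `2^d < p`, then `f` has INTEGER
degree `≤ d`: its indicator lies in `degLE ℤ ι d`.  Equivalently `deg_p(f) ≥ min(deg(f), log₂ p)`.
[cite: SunSunWangWuXiaZheng2020, Fact 2.1, Def. 2.2, Thm 1.4 (window 2^d < p; explicit statement: no printed locator known)]
[cite: GopalanLovettShpilka2010, §1.1 ("having low degree mod p is a singular event")] -/
theorem mem_degLE_int_of_mem_degLE_zmod {p : ℕ} [Fact p.Prime] {d : ℕ} (hpd : 2 ^ d < p)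
    (f : (ι → Bool) → Bool)
    (hf : (fun x => if f x then (1 : ZMod p) else 0) ∈ degLE (ZMod p) ι d) :
    (fun x => if f x then (1 : ℤ) else 0) ∈ degLE ℤ ι d :=
  mem_degLE_of_coeff_table_eq_zero _ (coeff_indicator_eq_zero_of_mem_degLE_zmod hpd f hf)

/-- The same over ANY commutative ring `R` (e.g. `ℝ`, `ℚ`, `ZMod q`): a Boolean function of
`𝔽_p`-degree `≤ d` with `2^d < p` has degree `≤ d` over `R`.
[cite: SunSunWangWuXiaZheng2020, Fact 2.1, Def. 2.2, Thm 1.4 (window 2^d < p)] [cite: LiSun2017, §2 Facts 1–2] -/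
theorem mem_degLE_of_mem_degLE_zmod {p : ℕ} [Fact p.Prime] {d : ℕ} (hpd : 2 ^ d < p)
    (R : Type*) [CommRing R] (f : (ι → Bool) → Bool)
    (hf : (fun x => if f x then (1 : ZMod p) else 0) ∈ degLE (ZMod p) ι d) :
    (fun x => if f x then (1 : R) else 0) ∈ degLE R ι d := by
  refine mem_degLE_of_coeff_table_eq_zero _ fun S hS => ?_
  have h0 := coeff_indicator_eq_zero_of_mem_degLE_zmod hpd f hf S hS
  have hcast : (fun T : Finset ι => if f (fun j => decide (j ∈ T)) then (1 : R) else 0) =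
      fun T => (Int.castRingHom R)
        ((fun T : Finset ι => if f (fun j => decide (j ∈ T)) then (1 : ℤ) else 0) T) := by
    funext T
    by_cases h : f (fun j => decide (j ∈ T)) <;> simp [h]
  rw [hcast, coeff_map, h0, map_zero]

end Main

/-! ### §5 Fourier form on `{0,1}^m` and the junta corollary -/

section Fourier

variable {m : ℕ}

/-- The coordinate function `[x_i]` has Fourier level `1`: `[x_i] = ½ − ½ χ_{i}`.
[cite: ODonnell2014, Ex. 1.9(d) (q(x) = p(1 − 2x) / the two representations)] -/
theorem isLevelLE_coord (i : Fin m) : IsLevelLE 1 (fun x : Fin m → Bool => if x i then (1 : ℝ) else 0) := by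
  have h : (fun x : Fin m → Bool => if x i then (1 : ℝ) else 0) =
      fun x => (1 / 2 : ℝ) + (-1 / 2 : ℝ) * Literature.Probability.RandomGraphs.LowDegree.walsh {i} x := by
    funext x
    unfold Literature.Probability.RandomGraphs.LowDegree.walsh
      Literature.Probability.RandomGraphs.LowDegree.sgn
    rw [prod_singleton]
    split_ifs <;> norm_num
  rw [h]
  exact (isLevelLE_const _ _).add ((isLevelLE_walsh {i} (by simp)).const_mul _)

/-- A monomial `x_S` has Fourier level `|S|`. [cite: ODonnell2014, §1.4 (degree of a product), Ex. 1.11(a)] -/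
theorem isLevelLE_cubeMono (S : Finset (Fin m)) : IsLevelLE S.card (cubeMono ℝ S) := by
  have h := IsLevelLE.prod S (d := fun _ => 1)
    (g := fun (i : Fin m) (x : Fin m → Bool) => if x i then (1 : ℝ) else 0)
    (fun i _ => isLevelLE_coord i)
  simp only [sum_const, smul_eq_mul, mul_one] at h
  exact h

/-- **`degLE ℝ ⊆ IsLevelLE`**: a real cube function in `span{x_S : |S| ≤ d}` has Fourier level `≤ d`
(the `{0,1}`- and `{±1}`-representations have the same degree).
[cite: ODonnell2014, Ex. 1.11(a), Ex. 1.10(b)] -/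
theorem isLevelLE_of_mem_degLE {d : ℕ} {F : (Fin m → Bool) → ℝ} (hF : F ∈ degLE ℝ (Fin m) d) :
    IsLevelLE d F := by
  unfold degLE at hF
  induction hF using Submodule.span_induction with
  | mem G hG =>
    obtain ⟨⟨U, hU⟩, rfl⟩ := hG
    exact (isLevelLE_cubeMono U).mono hU
  | zero => exact isLevelLE_zero d
  | add G H _ _ hG hH => exact hG.add hH
  | smul a G _ hG => exact hG.const_mul a

/-- **Fourier form**: a Boolean function on `{0,1}^m` of `𝔽_p`-degree `≤ d` with `2^d < p` has real
(Fourier) degree `≤ d`: its indicator has `IsLevelLE d`.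
[cite: SunSunWangWuXiaZheng2020, Thm 1.4 (window 2^d < p)] [cite: ODonnell2014, Ex. 1.11(a)] -/
theorem isLevelLE_of_mem_degLE_zmod {p : ℕ} [Fact p.Prime] {d : ℕ} (hpd : 2 ^ d < p)
    (f : (Fin m → Bool) → Bool)
    (hf : (fun x => if f x then (1 : ZMod p) else 0) ∈ degLE (ZMod p) (Fin m) d) :
    IsLevelLE d (fun x : Fin m → Bool => if f x then (1 : ℝ) else 0) :=
  isLevelLE_of_mem_degLE (mem_degLE_of_mem_degLE_zmod hpd ℝ f hf)

/-- The `±1` version `x ↦ (−1)^{f(x)}` also has Fourier level `≤ d`.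
[cite: ODonnell2014, Ex. 1.9(d), Ex. 1.11(a)] -/
theorem isLevelLE_sign_of_mem_degLE_zmod {p : ℕ} [Fact p.Prime] {d : ℕ} (hpd : 2 ^ d < p)
    (f : (Fin m → Bool) → Bool)
    (hf : (fun x => if f x then (1 : ZMod p) else 0) ∈ degLE (ZMod p) (Fin m) d) :
    IsLevelLE d (fun x : Fin m → Bool => if f x then (-1 : ℝ) else 1) := by
  have h : (fun x : Fin m → Bool => if f x then (-1 : ℝ) else 1) =
      fun x => (1 : ℝ) - 2 * (if f x then (1 : ℝ) else 0) := by
    funext x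
    split_ifs <;> norm_num
  rw [h]
  exact (isLevelLE_const 1 d).sub ((isLevelLE_of_mem_degLE_zmod hpd f hf).const_mul 2)

/-- **Junta corollary** (with the tree's Nisan–Szegedy theorem `nisanSzegedy_junta`): a Boolean
function on `{0,1}^m` of `𝔽_p`-degree `≤ d` with `2^d < p` depends on at most `d·2^{d−1}`
coordinates — there is `J`, `|J| ≤ d·2^{d−1}`, with `f x = f y` whenever `x, y` agree on `J`.
[cite: SunSunWangWuXiaZheng2020, Thm 1.4 (deg_p f ≤ p − 2 ⇒ bounded number of relevant variables; here the explicit window 2^d < p)]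
[cite: NisanSzegedy1994, junta theorem R(f) ≤ deg(f)·2^{deg(f)−1}] -/
theorem junta_of_mem_degLE_zmod {p : ℕ} [Fact p.Prime] {d : ℕ} (hpd : 2 ^ d < p)
    (f : (Fin m → Bool) → Bool)
    (hf : (fun x => if f x then (1 : ZMod p) else 0) ∈ degLE (ZMod p) (Fin m) d) :
    ∃ J : Finset (Fin m), J.card ≤ d * 2 ^ (d - 1) ∧
      ∀ x y : Fin m → Bool, (∀ i ∈ J, x i = y i) → f x = f y := by
  obtain ⟨J, hJ, hagree⟩ := NisanSzegedy.nisanSzegedy_junta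
    (fun x : Fin m → Bool => if f x then (-1 : ℝ) else 1)
    (fun x => by by_cases h : f x <;> simp [h]) (isLevelLE_sign_of_mem_degLE_zmod hpd f hf)
  refine ⟨J, by exact_mod_cast hJ, fun x y hxy => ?_⟩
  have h := hagree x y hxy
  cases hx : f x <;> cases hy : f y <;> simp [hx, hy] at h ⊢ <;> linarith

/-- The same with the `Smolensky.lowDeg` spelling of the hypothesis (`lowDeg (ZMod p) m d =
degLE (ZMod p) (Fin m) d` definitionally; this is the form `HasDegF p f d` of the qa-qnc0 cell
unfolds to). [cite: SunSunWangWuXiaZheng2020, Thm 1.4 (window 2^d < p)] [cite: NisanSzegedy1994, junta theorem] -/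
theorem junta_of_mem_lowDeg_zmod {p : ℕ} [Fact p.Prime] {d : ℕ} (hpd : 2 ^ d < p)
    (f : (Fin m → Bool) → Bool)
    (hf : (fun x => if f x then (1 : ZMod p) else 0) ∈
      Literature.Computability.MetaComplexity.Smolensky.lowDeg (ZMod p) m d) :
    ∃ J : Finset (Fin m), J.card ≤ d * 2 ^ (d - 1) ∧
      ∀ x y : Fin m → Bool, (∀ i ∈ J, x i = y i) → f x = f y :=
  junta_of_mem_degLE_zmod hpd f (by rwa [smolensky_lowDeg_eq_degLE] at hf)

end Fourier

/-! ### §6 Sharpness of the window `2^d < p` -/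

section Sharp

/-- **The window is sharp at `p = 3`, `d = 2`** (`2^2 = 4 > 3`): the Boolean function
`[x₁ + x₂ + x₃ = 2] = x₁x₂ + x₁x₃ + x₂x₃ − 3x₁x₂x₃` on `{0,1}^3` has `𝔽₃`-degree `≤ 2` (this
theorem) but integer degree `3` (next theorem); a symmetric-function instance as in the tight examples
of [cite: SunSunWangWuXiaZheng2020, Thm 1.4 (tightness: symmetric functions with period p)] and
[cite: LiSun2017, §2 Fact 4]. -/
theorem twoOfThree_mem_degLE_zmod_three :
    (fun x : Fin 3 → Bool =>
        if decide ((univ.filter fun i => x i = true).card = 2) then (1 : ZMod 3) else 0) ∈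
      degLE (ZMod 3) (Fin 3) 2 :=
  mem_degLE_of_coeff_table_eq_zero _ (by decide)

/-- … but integer degree `3`: its indicator is NOT in `degLE ℤ (Fin 3) 2` (the top Möbius coefficient
is `−3`). [cite: SunSunWangWuXiaZheng2020, Thm 1.4 (tightness)] [cite: LiSun2017, §2 Fact 4] -/
theorem twoOfThree_not_mem_degLE_int_two :
    (fun x : Fin 3 → Bool =>
        if decide ((univ.filter fun i => x i = true).card = 2) then (1 : ℤ) else 0) ∉
      degLE ℤ (Fin 3) 2 := by
  intro h
  have h0 := coeff_table_eq_zero_of_mem_degLE h Finset.univ (by decide)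
  revert h0
  decide

end Sharp

/-! ### §7 Gopalan–Lovett–Shpilka: a Boolean function depends on at most `deg(f)·2^{deg_p(f)−1}` coordinates

[GopalanLovettShpilka2010, §1.1, display after Cor. 1.3]: "one can show a stronger bound by a simple
modification of the Nisan–Szegedy proof: `deg(f) ≥ n/2^{deg_p(f)}`" (for `f` depending on all `n`
variables).  The modification: the discrete derivative `Δ_i f = f|_{x_i=1} − f|_{x_i=0}` takes values in
`{−1,0,1}`, so it is non-zero over `𝔽_p` exactly where it is non-zero over `ℤ`; over `𝔽_p` it has degree
`≤ deg_p(f) − 1`, so by Schwartz–Zippel on the cube (tree: `Smolensky.two_pow_le_two_pow_mul_card_support`)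
every RELEVANT coordinate has influence `≥ 2^{−(deg_p(f)−1)}`, while the total influence is `≤ deg(f)`
(tree: `NisanSzegedy.totalInfluence_le_degree`).  Hence `#relevant ≤ deg(f)·2^{deg_p(f)−1}` — the
Nisan–Szegedy junta bound with the (smaller) modular degree in the exponent. -/

section GLS

variable {ι : Type*} [Fintype ι] [DecidableEq ι] {R : Type*} [CommRing R]

omit [Fintype ι] in
/-- The characteristic vectors `𝟙_{T ∪ {i}}` and `𝟙_T` agree after overwriting coordinate `i`.
[cite: BorosHammer2002, §4.1 (characteristic vectors)] -/
theorem update_decide_mem_insert (T : Finset ι) (i : ι) (b : Bool) :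
    Function.update (fun j => decide (j ∈ insert i T)) i b =
      Function.update (fun j => decide (j ∈ T)) i b := by
  funext j
  by_cases hj : j = i
  · subst hj; simp
  · simp [hj]

omit [Fintype ι] in
/-- `𝟙_T` with coordinate `i ∉ T` overwritten by `true` is `𝟙_{T ∪ {i}}`; by `false` it is `𝟙_T`.
[cite: BorosHammer2002, §4.1 (characteristic vectors)] -/
theorem update_decide_mem_true (T : Finset ι) (i : ι) :
    Function.update (fun j => decide (j ∈ T)) i true = fun j => decide (j ∈ insert i T) := by
  funext j
  by_cases hj : j = i
  · subst hj; simp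
  · simp [hj]

omit [Fintype ι] in
/-- See `update_decide_mem_true`. [cite: BorosHammer2002, §4.1 (characteristic vectors)] -/
theorem update_decide_mem_false {T : Finset ι} {i : ι} (hi : i ∉ T) :
    Function.update (fun j => decide (j ∈ T)) i false = fun j => decide (j ∈ T) := by
  funext j
  by_cases hj : j = i
  · subst hj; simp [hi]
  · simp [hj]

/-- **The discrete derivative lowers the degree** (any direction `i`, any commutative ring):
`F ∈ degLE R ι d ⟹ Δ_i F := F|_{x_i=1} − F|_{x_i=0} ∈ degLE R ι (d − 1)` — on coefficients,
`c_T(Δ_i F) = c_{T ∪ {i}}(F)` for `i ∉ T` (`coeff_insert`) and `0` for `i ∈ T`.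
[cite: GopalanLovettShpilka2010, §3 (directional derivatives P_{(y,1)}(x) = P(x+y) − P(x) lower the degree)]
[cite: SunSunWangWuXiaZheng2020, Fact 2.5] -/
theorem derivAt_mem_degLE {d : ℕ} {F : (ι → Bool) → R} (hF : F ∈ degLE R ι d) (i : ι) :
    (fun x => F (Function.update x i true) - F (Function.update x i false)) ∈ degLE R ι (d - 1) := by
  refine mem_degLE_of_coeff_table_eq_zero _ fun T hT => ?_
  have h0 := coeff_table_eq_zero_of_mem_degLE hF
  by_cases hi : i ∈ T
  · refine coeff_eq_zero_of_forall_insert_eq _ (fun U => ?_) hi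
    simp only [update_decide_mem_insert]
  · have hsum : coeff (fun U : Finset ι => F (Function.update (fun j => decide (j ∈ U)) i true) -
          F (Function.update (fun j => decide (j ∈ U)) i false)) T =
        coeff (fun U : Finset ι => F (fun j => decide (j ∈ insert i U)) - F (fun j => decide (j ∈ U))) T := by
      unfold coeff
      refine sum_congr rfl fun U hU => ?_
      have hiU : i ∉ U := fun h => hi (mem_powerset.1 hU h)
      simp only [update_decide_mem_true, update_decide_mem_false hiU]
    rw [hsum, coeff_sub]
    have hci := coeff_insert (fun U : Finset ι => F (fun j => decide (j ∈ U))) hi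
    beta_reduce at hci
    rw [← hci]
    exact h0 _ (by rw [card_insert_of_notMem hi]; omega)

variable {m : ℕ}

/-- Pivotality of coordinate `i` at `x` is detected by the `𝔽_p`-valued derivative of the indicator:
`f(x) ≠ f(x^{⊕i}) ⟺ 𝟙_f(x^{i←1}) − 𝟙_f(x^{i←0}) ≠ 0` in `ZMod p` (values `0, ±1`).
[cite: GopalanLovettShpilka2010, §1.1 (modification of the Nisan–Szegedy proof)] -/
theorem ne_flip_iff_derivAt_ne_zero {p : ℕ} [Fact p.Prime] (f : (Fin m → Bool) → Bool)
    (i : Fin m) (x : Fin m → Bool) :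
    f x ≠ f (Function.update x i (!x i)) ↔
      (if f (Function.update x i true) then (1 : ZMod p) else 0) -
        (if f (Function.update x i false) then (1 : ZMod p) else 0) ≠ 0 := by
  have key : (f x ≠ f (Function.update x i (!x i))) ↔
      f (Function.update x i true) ≠ f (Function.update x i false) := by
    cases hxi : x i
    · have hx : Function.update x i false = x := by rw [← hxi, Function.update_eq_self]
      simp only [Bool.not_false, hx]
      exact ne_comm
    · have hx : Function.update x i true = x := by rw [← hxi, Function.update_eq_self]
      simp only [Bool.not_true, hx]
  rw [key]
  cases f (Function.update x i true) <;> cases f (Function.update x i false) <;> simp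

/-- **Each relevant coordinate of a Boolean function of `𝔽_p`-degree `≤ d` has influence
`≥ 2^{−(d−1)}`** (the `±1` version `g = (−1)^f`; Schwartz–Zippel over `𝔽_p` for `Δ_i 𝟙_f`, of degree
`≤ d − 1` and non-zero). [cite: GopalanLovettShpilka2010, §1.1 (display after Cor. 1.3, "a simple modification of the Nisan–Szegedy proof")] -/
theorem influence_ge_of_mem_degLE_zmod {p : ℕ} [Fact p.Prime] {d : ℕ} (f : (Fin m → Bool) → Bool)
    (hf : (fun x => if f x then (1 : ZMod p) else 0) ∈ degLE (ZMod p) (Fin m) d) {i : Fin m}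
    (hi : KKL.influence i (fun x => if f x then (-1 : ℝ) else 1) ≠ 0) :
    (1 / 2 : ℝ) ^ (d - 1) ≤ KKL.influence i (fun x => if f x then (-1 : ℝ) else 1) := by
  set Δ : (Fin m → Bool) → ZMod p := fun x =>
    (if f (Function.update x i true) then (1 : ZMod p) else 0) -
      (if f (Function.update x i false) then (1 : ZMod p) else 0) with hΔ
  have hΔdeg : Δ ∈ Literature.Computability.MetaComplexity.Smolensky.lowDeg (ZMod p) m (d - 1) := by
    rw [smolensky_lowDeg_eq_degLE]; exact derivAt_mem_degLE hf i
  -- the pivotal set of `g` is the support of `Δ`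
  have hset : ∀ x : Fin m → Bool,
      ((fun x => if f x then (-1 : ℝ) else 1) x ≠
          (fun x => if f x then (-1 : ℝ) else 1) (Function.update x i (!x i))) ↔ Δ x ≠ 0 := by
    intro x
    rw [← ne_flip_iff_derivAt_ne_zero f i x]
    constructor
    · intro h hfx; exact h (by simp only [hfx])
    · intro h hgx
      apply h
      cases hx : f x <;> cases hy : f (Function.update x i (!x i)) <;>
        simp [hx, hy] at hgx ⊢ <;> norm_num at hgx
  have hne : Δ ≠ 0 := by
    intro h0
    apply hi
    unfold KKL.influence
    rw [sum_eq_zero fun x _ => by rw [if_neg (fun h => ((hset x).1 h) (by rw [h0]; rfl))], zero_div]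
  have hSZ := Literature.Computability.MetaComplexity.Smolensky.two_pow_le_two_pow_mul_card_support
    hΔdeg hne
  -- `2^m ≤ 2^{d-1} · #supp Δ`, and `Inf_i = #supp Δ / 2^m`
  have hcount : (∑ x : Fin m → Bool, if (fun x => if f x then (-1 : ℝ) else 1) x ≠
        (fun x => if f x then (-1 : ℝ) else 1) (Function.update x i (!x i)) then (1 : ℝ) else 0) =
      ((univ.filter fun x : Fin m → Bool => Δ x ≠ 0).card : ℝ) := by
    rw [← sum_boole]
    exact sum_congr rfl fun x _ => if_congr (hset x) rfl rfl
  unfold KKL.influence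
  rw [hcount, le_div_iff₀ (by positivity)]
  have h' : ((2 : ℕ) ^ m : ℝ) ≤ ((2 : ℕ) ^ (d - 1) * (univ.filter fun x : Fin m → Bool => Δ x ≠ 0).card : ℝ) := by
    exact_mod_cast hSZ
  push_cast at h'
  have hpow : (1 / 2 : ℝ) ^ (d - 1) * 2 ^ (d - 1) = 1 := by
    rw [one_div_pow, one_div, inv_mul_cancel₀ (by positivity)]
  calc (1 / 2 : ℝ) ^ (d - 1) * 2 ^ m
      ≤ (1 / 2 : ℝ) ^ (d - 1) * (2 ^ (d - 1) * ((univ.filter fun x : Fin m → Bool => Δ x ≠ 0).card : ℝ)) :=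
        mul_le_mul_of_nonneg_left h' (by positivity)
    _ = ((univ.filter fun x : Fin m → Bool => Δ x ≠ 0).card : ℝ) := by rw [← mul_assoc, hpow, one_mul]

/-- **Gopalan–Lovett–Shpilka's strengthening of the Nisan–Szegedy bound**: a Boolean function of
real (Fourier) degree `≤ D` and `𝔽_p`-degree `≤ d` has at most `D·2^{d−1}` coordinates of non-zero
influence ("`deg(f) ≥ n/2^{deg_p(f)}`" for `f` depending on all `n` variables).
[cite: GopalanLovettShpilka2010, §1.1 (display after Cor. 1.3)] [cite: NisanSzegedy1994, junta theorem (the case d = D)] -/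
theorem card_relevant_le_of_mem_degLE_zmod {p : ℕ} [Fact p.Prime] {d D : ℕ} (f : (Fin m → Bool) → Bool)
    (hf : (fun x => if f x then (1 : ZMod p) else 0) ∈ degLE (ZMod p) (Fin m) d)
    (hD : IsLevelLE D (fun x : Fin m → Bool => if f x then (-1 : ℝ) else 1)) :
    ((univ.filter fun i : Fin m =>
        KKL.influence i (fun x => if f x then (-1 : ℝ) else 1) ≠ 0).card : ℝ) ≤ (D : ℝ) * 2 ^ (d - 1) := by
  set g : (Fin m → Bool) → ℝ := fun x => if f x then (-1 : ℝ) else 1 with hg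
  have hg1 : ∀ x, g x = 1 ∨ g x = -1 := fun x => by by_cases h : f x <;> simp [hg, h]
  set Rel := univ.filter fun i : Fin m => KKL.influence i g ≠ 0
  have h1 : (Rel.card : ℝ) * (1 / 2 : ℝ) ^ (d - 1) ≤ ∑ i ∈ Rel, KKL.influence i g := by
    rw [← nsmul_eq_mul, ← sum_const]
    exact sum_le_sum fun i hi => influence_ge_of_mem_degLE_zmod f hf (mem_filter.1 hi).2
  have h2 : ∑ i ∈ Rel, KKL.influence i g ≤ KKL.totalInfluence g := by
    unfold KKL.totalInfluence
    exact sum_le_sum_of_subset_of_nonneg (filter_subset _ _) fun i _ _ => KKL.influence_nonneg i g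
  have h3 := NisanSzegedy.totalInfluence_le_degree g hg1 hD
  have hpow : (1 / 2 : ℝ) ^ (d - 1) * 2 ^ (d - 1) = 1 := by
    rw [one_div_pow, one_div, inv_mul_cancel₀ (by positivity)]
  have hpos : (0 : ℝ) < 2 ^ (d - 1) := by positivity
  calc (Rel.card : ℝ) = (Rel.card : ℝ) * (1 / 2 : ℝ) ^ (d - 1) * 2 ^ (d - 1) := by
        rw [mul_assoc, hpow, mul_one]
    _ ≤ (D : ℝ) * 2 ^ (d - 1) := by
        have := mul_le_mul_of_nonneg_right (le_trans (le_trans h1 h2) h3) hpos.le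
        linarith

/-- **Junta form of the GLS bound**: a Boolean function of real degree `≤ D` and `𝔽_p`-degree `≤ d`
depends on at most `D·2^{d−1}` coordinates. [cite: GopalanLovettShpilka2010, §1.1 (display after Cor. 1.3)]
[cite: NisanSzegedy1994, junta theorem] -/
theorem junta_of_mem_degLE_zmod_of_isLevelLE {p : ℕ} [Fact p.Prime] {d D : ℕ} (f : (Fin m → Bool) → Bool)
    (hf : (fun x => if f x then (1 : ZMod p) else 0) ∈ degLE (ZMod p) (Fin m) d)
    (hD : IsLevelLE D (fun x : Fin m → Bool => if f x then (-1 : ℝ) else 1)) :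
    ∃ J : Finset (Fin m), J.card ≤ D * 2 ^ (d - 1) ∧
      ∀ x y : Fin m → Bool, (∀ i ∈ J, x i = y i) → f x = f y := by
  have hcard := card_relevant_le_of_mem_degLE_zmod f hf hD
  refine ⟨univ.filter fun i : Fin m =>
      KKL.influence i (fun x : Fin m → Bool => if f x then (-1 : ℝ) else 1) ≠ 0,
    by exact_mod_cast hcard, fun x y hxy => ?_⟩
  have h := NisanSzegedy.eq_of_agree_on_relevant (fun x : Fin m → Bool => if f x then (-1 : ℝ) else 1)
    x y fun i hi => hxy i (mem_filter.2 ⟨mem_univ i, hi⟩)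
  cases hx : f x <;> cases hy : f y <;> simp [hx, hy] at h ⊢ <;> linarith

end GLS

end ModularDegree

end Literature.Computability.Complexity.LowDegree
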